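import Summits.BirchSwinnertonDyer.BirchSwinnertonDyer.Theses.UniversalToricDescent
import Summits.BirchSwinnertonDyer.BirchSwinnertonDyer.Theorems.UniversalToricDescentToricTransportModThreeStubRatDescent
import Summits.BirchSwinnertonDyer.BirchSwinnertonDyer.Theorems.UniversalToricDescentThinCombDefs
import Summits.BirchSwinnertonDyer.BirchSwinnertonDyer.Theorems.UniversalToricDescentThinCombWeakReflection
import Summits.BirchSwinnertonDyer.BirchSwinnertonDyer.Theorems.UniversalToricDescentAdditiveSplitIMCInclusionAtThreeStubCharIdealPrincipal
import Summits.BirchSwinnertonDyer.BirchSwinnertonDyer.Theorems.UniversalToricDescentAdditiveSplitIMCInclusionAtThreeStubFrame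
import Summits.BirchSwinnertonDyer.BirchSwinnertonDyer.Theorems.UniversalToricDescentToricTransportModThreeNormProfile
import Summits.BirchSwinnertonDyer.BirchSwinnertonDyer.Theorems.SignedBaseChangeAnticyclotomicEisensteinDivisibilityXGrTwoModuleFinite
import Summits.BirchSwinnertonDyer.Rank1Residual.X2.HidaLimitCongruenceAlgebra
import Literature.NumberTheory.EllipticCurves.TwoVariableSelmerDual
import Literature.NumberTheory.EllipticCurves.ZpExtensionSplitPrimeLineThroughPair
import HarnessLib

/-!
# Line `ratwall_thin_comb` re-targeted at the NEW crux `RationalSplitIMCInclusionAtThree` (stmt-BirchSwinnertonDyer-24207)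
# — pen-typed PROPOSAL skeleton (pen bsd-wall-pss3x g8, 2026-08-29; RK-6 v2 rev 80/81). Registration is a LEAD act.

After RK-6 v2 the route's deciding package `ToricDefectEitherRoadAtThree` (24209) accepts the RATIONAL road
A ∧ RATWALL ∧ μ_twin, and the rational wall is a first-class item (24207, support → crux r204 after vet). This file is the
middle third of LEAD utd-p1 g19's registered line `Cruxes/ToricTransportModThree/Lines/ratwall_thin_comb.lean` (v2,
2f6f153a9e914ebb), cut so that it concludes 24207 BY NAME instead of the parent 20186:

* `stub_ratCombSupply` — VERBATIM the registered research stub of ratwall v2 (rational comb supply: torsion, weak reflection ρ,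
  L₂ with ρG ∼ G, ρL₂ ∼ L₂, rational comparison with two-sided slack (t, s), `ThinCombDvdRat`). THE research content.
* `stub_noPseudoNull` — VERBATIM the shared print stub (Greenberg 2016 Prop 4.1.1; in tree closed modulo two named facts).
* the rational descent is NOT a stub here: it is the LANDED theorem `…Cruxes.ToricTransportModThree.RatwallThinComb.stub_ratDescent`
  (p703976), cited by name; frame / principal generator / finiteness / weak-reflection bookkeeping are tree theorems as in v2.
* `RationalSplitIMCInclusionAtThree_of` — kernel-checked composition (no `sorry` outside the two stubs) concluding
  `Summit.BirchSwinnertonDyer.BirchSwinnertonDyer.Theses.UniversalToricDescent.RationalSplitIMCInclusionAtThree` BY NAME.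

Consequences: the squeeze (`stub_ratSqueeze` p703763), `InvariantsTransportModThree` and `TwinMuZeroAtThree` of ratwall v2 are NOT
needed for 24207 — they live downstream in kernel_rat (24208) / the package. Shared stubs close together with ratwall v2 and
thin_comb (same names, same signatures). HONESTY: nothing here is evidence that the rational comb supply exists at an additive
split 3; BSD is not proved by any of this; 24207, 20395, 20186 OPEN.
-/

set_option linter.dupNamespace false
set_option autoImplicit false

noncomputable section

open NumberField IsDedekindDomain Field
open Literature.NumberTheory.EllipticCurves
open Summit.BirchSwinnertonDyer.BirchSwinnertonDyer.Theorems.UniversalToricDescentThinComb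

namespace Summit.BirchSwinnertonDyer.BirchSwinnertonDyer.Cruxes.RationalSplitIMCInclusionAtThree.RatwallThinComb

/-- **stub_ratCombSupply** (THE research stub, crux-sized XL; = v2's `stub_twoVarCombSupply` in RATIONAL currency):
for every BDP frame `L` of `f_E` and the PINNED generator `g` of `ch_{Λ₂}(X₂)` in a v2 frame: `X₂` is `Λ₂`-torsion, and
there are a WEAK reflection `ρ` (fixes constants, `ρ T₂ ∉ (3, T₂)`) and `L₂ ∈ Λ₂(R₀)` with `ρ G ∼ G` (K4, in print:
Nekovář 2006), `ρ L₂ ∼ L₂` (K3(iii)), the RATIONAL comparison `3^t·L₂ ≡ u·3^s·L(T₁) (mod 𝔞_k)` (K3(ii) up to a power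
of 3) and RATIONAL comb divisibility `ThinCombDvdRat R₀ 3 G L₂` (K2: `G ∣ 3^{t_m}·L₂ (mod E_m(T₂))` on levels of
unbounded order — what one Euler-system argument per 3-power twist delivers, slack allowed). Why it might fail: as v2's
research stub (no reciprocity law for Beilinson–Flach classes at a supercuspidal `p ∣ N` in print; no typed toric
two-variable `L₂` at `3 ∣ N`); the integrality input is GONE. -/
theorem stub_ratCombSupply :
    ∀ (W : WeierstrassCurve ℚ) [W.IsElliptic] [W.IsGloballyMinimal] (N : ℕ) [NeZero N] (K : Type) [Field K]
      [NumberField K] (Dt : Literature.NumberTheory.EllipticCurves.ModularForms.ModularParametrizationData W N),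
    Summit.BirchSwinnertonDyer.Rank1Residual.Additive.ClassO6 W 3 → W.HasSurjectiveModNGaloisRep 3 →
    W.analyticRank = 1 → W.conductorNorm ℤ = N → IsImaginaryQuadratic K → SatisfiesHeegnerHypothesis N K →
    ∀ (κ : ZpExtension K 3), κ.IsAnticyclotomic → ∀ (γ : Field.absoluteGaloisGroup K) [Fact (κ.IsTopGenerator γ)]
      (𝔭 : HeightOneSpectrum (𝓞 K)), ((3 : ℕ) : 𝓞 K) ∈ 𝔭.asIdeal →
      𝔭.asIdeal.ramificationIdx (𝓞 ℚ) = 1 → 𝔭.asIdeal.inertiaDeg (𝓞 ℚ) = 1 →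
    ∀ (𝔭' : HeightOneSpectrum (𝓞 K)), ((3 : ℕ) : 𝓞 K) ∈ 𝔭'.asIdeal → 𝔭' ≠ 𝔭 →
    ∀ (ι' : PadicAlgCl 3 ≃+* ℂ), Summit.BirchSwinnertonDyer.BirchSwinnertonDyer.Theorems.SchneiderFree.BranchInducesPrime 3 ι' 𝔭 →
    ∀ (κ₁ κ₂ : ZpExtension K 3) (γ₁ γ₂ : Field.absoluteGaloisGroup K) (k : ℕ)
      [Fact (ZpExtension.IsTopGeneratorPair κ₁ κ₂ γ₁ γ₂)],
    (∀ v : HeightOneSpectrum (𝓞 K), v ≠ 𝔭 → ∀ 𝔓 ∈ v.primesAbove,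
        𝔓.inertia (Field.absoluteGaloisGroup K) ≤ κ₁.kerSubgroup) →
    ZpExtension.pairKer κ₁ κ₂ ≤ κ.kerSubgroup → γ₁ * γ⁻¹ ∈ κ.kerSubgroup → γ₂ * (γ ^ (3 ^ k))⁻¹ ∈ κ.kerSubgroup →
    ∀ (g : IwasawaAlgebra₂ 3),
      Literature.NumberTheory.EllipticCurves.Module.charIdeal (IwasawaAlgebra₂ 3)
        ((W.baseChange K).XGr₂ 3 κ₁ κ₂ 𝔭' γ₁ γ₂) = Ideal.span {g} →
    ∀ (ΩK : ℂ) (Ωp : ℂ_[3]) (L : UnrSeries 3), ΩK ≠ 0 → Ωp ≠ 0 →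
      IsBDPLFunction ι' 𝔭 κ γ Dt.f ΩK Ωp L →
    Module.IsTorsion (IwasawaAlgebra₂ 3) ((W.baseChange K).XGr₂ 3 κ₁ κ₂ 𝔭' γ₁ γ₂) ∧
    ∃ (ρ : PowerSeries (PowerSeries (unrIntegers 3)) ≃+* PowerSeries (PowerSeries (unrIntegers 3)))
      (L₂ : PowerSeries (PowerSeries (unrIntegers 3))),
      (∀ c : unrIntegers 3, ρ (const (unrIntegers 3) c) = const (unrIntegers 3) c) ∧
      ρ (T₂ (unrIntegers 3)) ∉ Ideal.span {const (unrIntegers 3) ((3 : ℕ) : unrIntegers 3), T₂ (unrIntegers 3)} ∧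
      Associated (ρ (PowerSeries.map (PowerSeries.map
        (Summit.BirchSwinnertonDyer.Rank1Residual.X11b.Halves.toUnr 3)) g))
        (PowerSeries.map (PowerSeries.map (Summit.BirchSwinnertonDyer.Rank1Residual.X11b.Halves.toUnr 3)) g) ∧
      Associated (ρ L₂) L₂ ∧
      (∃ (u : (PowerSeries (PowerSeries (unrIntegers 3)))ˣ) (t s : ℕ),
        const (unrIntegers 3) (((3 : ℕ) : unrIntegers 3) ^ t) * L₂ -
          u * const (unrIntegers 3) (((3 : ℕ) : unrIntegers 3) ^ s) *
            PowerSeries.map (PowerSeries.C (R := unrIntegers 3)) L ∈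
          Ideal.span {T₂ (unrIntegers 3) - ((1 + T₁ (unrIntegers 3)) ^ (3 ^ k) - 1)}) ∧
      ThinCombDvdRat (unrIntegers 3) 3
        (PowerSeries.map (PowerSeries.map (Summit.BirchSwinnertonDyer.Rank1Residual.X11b.Halves.toUnr 3)) g) L₂ := by
  sorry

/-- **stub_noPseudoNull** (support, L, PRINT; VERBATIM the registered `stub_noPseudoNull` of line `thin_comb` v3/v4 on the
child 20395 — shared, closes together): every pseudo-null `Λ₂`-submodule of the torsion `X₂ = XGr₂ (E/K) 3 κ₁ κ₂ 𝔭′ γ₁ γ₂` is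
finite. In tree CLOSED MODULO two published named facts (`…ThinComb.DescentNoPseudoNullOfFacts.stub_noPseudoNull_of_prop411_of_tateTC`:
Greenberg 2016 Prop. 4.1.1, Tate's global Euler characteristic at totally complex fields). -/
theorem stub_noPseudoNull :
    ∀ (W : WeierstrassCurve ℚ) [W.IsElliptic] [W.IsGloballyMinimal] (K : Type) [Field K] [NumberField K],
    Summit.BirchSwinnertonDyer.Rank1Residual.Additive.ClassO6 W 3 → W.HasSurjectiveModNGaloisRep 3 →
    IsImaginaryQuadratic K →
    ∀ (κ : ZpExtension K 3), κ.IsAnticyclotomic → ∀ (γ : Field.absoluteGaloisGroup K) [Fact (κ.IsTopGenerator γ)]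
      (𝔭 : HeightOneSpectrum (𝓞 K)), ((3 : ℕ) : 𝓞 K) ∈ 𝔭.asIdeal →
    ∀ (𝔭' : HeightOneSpectrum (𝓞 K)), ((3 : ℕ) : 𝓞 K) ∈ 𝔭'.asIdeal → 𝔭' ≠ 𝔭 →
    ∀ (κ₁ κ₂ : ZpExtension K 3) (γ₁ γ₂ : Field.absoluteGaloisGroup K) (k : ℕ)
      [Fact (ZpExtension.IsTopGeneratorPair κ₁ κ₂ γ₁ γ₂)],
    (∀ v : HeightOneSpectrum (𝓞 K), v ≠ 𝔭 → ∀ 𝔓 ∈ v.primesAbove,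
        𝔓.inertia (Field.absoluteGaloisGroup K) ≤ κ₁.kerSubgroup) →
    ZpExtension.pairKer κ₁ κ₂ ≤ κ.kerSubgroup → γ₁ * γ⁻¹ ∈ κ.kerSubgroup → γ₂ * (γ ^ (3 ^ k))⁻¹ ∈ κ.kerSubgroup →
    Module.Finite (IwasawaAlgebra₂ 3) ((W.baseChange K).XGr₂ 3 κ₁ κ₂ 𝔭' γ₁ γ₂) →
    Module.IsTorsion (IwasawaAlgebra₂ 3) ((W.baseChange K).XGr₂ 3 κ₁ κ₂ 𝔭' γ₁ γ₂) →
    ∀ N : Submodule (IwasawaAlgebra₂ 3) ((W.baseChange K).XGr₂ 3 κ₁ κ₂ 𝔭' γ₁ γ₂),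
      Literature.NumberTheory.EllipticCurves.Module.IsPseudoNull (IwasawaAlgebra₂ 3) N → Finite N := by
  sorry

/-- **Composition** (kernel-checked, no `sorry` outside the two stubs): rational comb supply + weak-reflection bookkeeping
(tree) + no-pseudo-null + the LANDED rational descent (p703976) give the rational wall `∃ k', 3^{k'}·L ∈ Ch·R₀⟦T⟧` BY NAME. -/
theorem RationalSplitIMCInclusionAtThree_of :
    Summit.BirchSwinnertonDyer.BirchSwinnertonDyer.Theses.UniversalToricDescent.RationalSplitIMCInclusionAtThree := by
  intro W _ _ N _ K _ _ Dt hO6 hsurj hrk hN hK hH κ hκ γ hγ 𝔭 h3 hram hdeg 𝔭' h3' hne ι' hι ΩK Ωp L hΩK hΩp hL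
  obtain ⟨κ₁, κ₂, γ₁, γ₂, k, hpair, hur₁, hker, hγ₁, hγ₂⟩ :=
    Summit.BirchSwinnertonDyer.BirchSwinnertonDyer.Theorems.UniversalToricDescentThinCombLine.stub_frame
      K hK κ hκ γ hγ.out 𝔭 h3 𝔭' h3' hne
  haveI : Fact (ZpExtension.IsTopGeneratorPair κ₁ κ₂ γ₁ γ₂) := ⟨hpair⟩
  obtain ⟨g₂, hg₂⟩ :=
    Summit.BirchSwinnertonDyer.BirchSwinnertonDyer.Theorems.UniversalToricDescentThinCombLine.stub_charIdealPrincipal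
      ((W.baseChange K).XGr₂ 3 κ₁ κ₂ 𝔭' γ₁ γ₂)
  have hg₂' : Literature.NumberTheory.EllipticCurves.Module.charIdeal (IwasawaAlgebra₂ 3)
      ((W.baseChange K).XGr₂ 3 κ₁ κ₂ 𝔭' γ₁ γ₂) = Ideal.span {g₂} := by
    simpa [Ideal.submodule_span_eq] using hg₂
  have hfin : Module.Finite (IwasawaAlgebra₂ 3) ((W.baseChange K).XGr₂ 3 κ₁ κ₂ 𝔭' γ₁ γ₂) :=
    Summit.BirchSwinnertonDyer.BirchSwinnertonDyer.Theorems.SignedBaseChangeAcDivFinitePiece.xGr₂_module_finite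
      (W.baseChange K) 3 κ₁ κ₂ 𝔭'
  obtain ⟨htors, ρ, L₂, hρc, hρT, hGsym, hLsym, hcmp, hcomb⟩ :=
    stub_ratCombSupply W N K Dt hO6 hsurj hrk hN hK hH κ hκ γ 𝔭 h3 hram hdeg 𝔭' h3' hne ι' hι κ₁ κ₂ γ₁ γ₂ k
      hur₁ hker hγ₁ hγ₂ g₂ hg₂' ΩK Ωp L hΩK hΩp hL
  haveI := Summit.BirchSwinnertonDyer.Rank1Residual.X2.HidaLimitAlgebra.isDiscreteValuationRing_unrIntegers (p := 3)
  have hmax : IsLocalRing.maximalIdeal (unrIntegers 3) = Ideal.span {((3 : ℕ) : unrIntegers 3)} :=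
    (IsDiscreteValuationRing.irreducible_iff_uniformizer _).mp
      Summit.BirchSwinnertonDyer.Rank1Residual.X2.HidaLimitAlgebra.irreducible_natCast_p
  obtain ⟨a, hdvd⟩ := dvd_pow_mul_of_weakReflection (unrIntegers 3) 3 hmax ρ hρc hρT _ L₂ hGsym hLsym hcomb
  have hPN := stub_noPseudoNull W K hO6 hsurj hK κ hκ γ 𝔭 h3 𝔭' h3' hne κ₁ κ₂ γ₁ γ₂ k hur₁ hker hγ₁ hγ₂ hfin htors
  exact Summit.BirchSwinnertonDyer.BirchSwinnertonDyer.Cruxes.ToricTransportModThree.RatwallThinComb.stub_ratDescent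
    W K hO6 hsurj hK κ hκ γ 𝔭 h3 𝔭' h3' hne κ₁ κ₂ γ₁ γ₂ k hur₁ hker hγ₁ hγ₂ hfin htors hPN g₂ hg₂' L₂ L a hdvd hcmp

end Summit.BirchSwinnertonDyer.BirchSwinnertonDyer.Cruxes.RationalSplitIMCInclusionAtThree.RatwallThinComb

end
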